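import Summits.NavierStokesRegularity.NavierStokesRegularity.Theorems.QuarterLogPincerLogCubeCeilingTools
import Literature.Analysis.FunctionSpaces.MinkowskiIntegral
import Literature.Analysis.FluidPDE.ForcedOseenRepresentationClassical
import Literature.Analysis.FluidPDE.KatoBilinearEstimates
import Literature.Analysis.FluidPDE.NSCriticalClosureTao
import Literature.Analysis.FluidPDE.TaoLocalisation
import Summits.NavierStokesRegularity.NavierStokesRegularity.Theorems.TypeICertificateLadderRungReynoldsOneTaoCover
import Summits.NavierStokesRegularity.NavierStokesRegularity.Theses.QuarterLogPincer
import HarnessLib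

/-!
# `QuarterLogPincer.LogCubeCeiling` (item stmt-NavierStokesRegularity-23362): under the quarter-rate
# enstrophy law the critical `L³` norm grows at most logarithmically

**Statement (the route decl, verbatim).** For a classical solution `(u,p)` of the unforced
Navier–Stokes system on `ℝ³ × [0,T)` (`ν, T > 0`), Leray–Hopf from its rapidly decaying datum, with
`∫|curl u(t)|² ≤ K/√(T−t)` on `[0,T)` (and the velocity Type-I rate, which is NOT used), there are
`C₁, C₂` with `‖u(t)‖_{L³} ≤ C₁ + C₂ log(T/(T−t))` for all `t ∈ [0,T)`.

PROOF — THE DUHAMEL ROAD (not the `L³` energy identity; no pressure estimate is needed). On every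
closed sub-slab `[0,t]`, `t < T`, the solution is bounded with finite energy (Tao-class cover,
`RungReynoldsOne.stub_taoCover`), hence obeys the Oseen representation
`u(t) = e^{νtΔ}u(0) − B^ν_0(u,u)(t)` a.e. (`IsClassicalNSSolutionOn.ae_eq_forced_oseenMild`, zero
force). The caloric term contracts `L³`. For the bilinear term, Minkowski in time and the diagonal
`L³` bound of the Oseen slice operator, `‖e^{σΔ}P∇·(a⊗b)‖₃ ≤ C σ^{-1/2} ‖a‖₆‖b‖₆`
(`exists_eLpNorm_three_oseenSlice_le`, Kato 1984 (2.3); Lemarié-Rieusset 2016, Thm. 7.5), combined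
with Sobolev `Ḣ¹ ⊂ L⁶` against the enstrophy, `‖u(τ)‖₆² ≤ K_S² ∫|curl u(τ)|² ≤ K_S² K/√(T−τ)`, give
`‖B^ν_0(u,u)(t)‖₃ ≤ C ν^{-1/2} K_S² K⁺ ∫₀ᵗ (t−τ)^{-1/2}(T−τ)^{-1/2} dτ ≤ C ν^{-1/2} K_S² K⁺ (2 + √2 log(T/(T−t)))`
(split the time integral at `2t − T`; `lintegral_kernel_le_log` and `eLpNorm_six_mul_self_le_curl`
in the tools file `QuarterLogPincerLogCubeCeilingTools.lean`). Every critical pair of a-priori bounds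
integrates to a log by scaling; here the pair is (Oseen kernel gradient in `L¹`, enstrophy at Leray's
rate). Remark (critic P1 of the line): the Duhamel road lands at NORM `≤ C log`, i.e. cube
`≤ C³ log³`; it does not see the template rate cube `≍ log`.

HONEST FRAMING: a conditional a-priori estimate for a GIVEN classical solution under a HYPOTHESISED
enstrophy law (route `QuarterLogPincer`, converter crux); the quarter law (`EnstrophyQuarterLaw`,
stmt-1574) and the deciding crux `SuperlogTypeIRate` stay open. Navier–Stokes regularity is NOT
proved by this file, nor claimed. References: Kato 1984 §2 (2.3); Lemarié-Rieusset 2016 Thm. 6.1,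
Thm. 7.5; Koch–Nadirashvili–Seregin–Šverák 2009 §4. [folklore]
-/

noncomputable section

open Set Filter Topology MeasureTheory Function
open scoped ENNReal NNReal
open Literature.Analysis Literature.Analysis.FluidPDE

namespace Summit.NavierStokesRegularity.NavierStokesRegularity.Theorems

-- the problem directory repeats the summit name (`NavierStokesRegularity/NavierStokesRegularity`)
set_option linter.dupNamespace false

namespace LogCubeCeiling

/-! ### The slab estimate -/

/-- **The `L³` Duhamel estimate on a closed slab.** Let `(u,p)` be a classical solution of the
unforced system (`ν > 0`) on `[0,S] × ℝ³`, bounded by `M` with finite energy, and suppose the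
quarter-rate law `∫|curl u(τ)|² ≤ K/√(T−τ)` on `[0,S]`, `S < T`. Let `C` be a constant of the diagonal
`L³` bound of the Oseen slice operator (`‖e^{σΔ}P∇·(a⊗b)‖₃ ≤ C σ^{-1/2} ‖a‖₆ ‖b‖₆`). Then for every
`s ∈ (0,S]`,
`‖u(s)‖₃ ≤ ‖u(0)‖₃ + C ν^{-1/2} K_S² max(K,0) · (2 + √2 log(T/(T−s)))`
(Oseen representation `u(s) = e^{νsΔ}u(0) − B^ν_0(u,u)(s)`, `L³` contraction of the heat flow,
Minkowski in time, the slice bound, Sobolev against the enstrophy and `lintegral_kernel_le_log`).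
[cite: Kato1984, §2 (2.3)] [cite: LemarieRieusset2016, Thm. 6.1 (6.12) and Thm. 7.5] -/
theorem slab {ν T S K M C : ℝ} (hν : 0 < ν) (hS : 0 < S) (hST : S < T)
    {u : ℝ → (EuclideanSpace ℝ (Fin 3)) → (EuclideanSpace ℝ (Fin 3))} {p : ℝ → (EuclideanSpace ℝ (Fin 3)) → ℝ} (hcl : IsClassicalNSSolutionOn (Icc 0 S) ν 0 u p)
    (hE : ∃ C' : ℝ≥0∞, C' < ⊤ ∧ ∀ t ∈ Icc 0 S, ∫⁻ x, ‖u t x‖ₑ ^ 2 ≤ C')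
    (hM : 0 < M) (hMb : ∀ t ∈ Icc 0 S, ∀ y, ‖u t y‖ ≤ M)
    (hquarter : ∀ t ∈ Icc 0 S,
      ∫⁻ x, ‖curl (u t) x‖ₑ ^ 2 ≤ ENNReal.ofReal (K / Real.sqrt (T - t)))
    (hC0 : 0 ≤ C)
    (hC : ∀ {σ : ℝ}, 0 < σ → ∀ {a b : (EuclideanSpace ℝ (Fin 3)) → (EuclideanSpace ℝ (Fin 3))}, AEStronglyMeasurable a volume →
      AEStronglyMeasurable b volume →
        eLpNorm (fun x => ∫ y, oseenKernel σ (x - y) (a y) (b y)) 3 volume ≤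
          ENNReal.ofReal (C * σ ^ (-(1 / 2 : ℝ))) * (eLpNorm a 6 volume * eLpNorm b 6 volume))
    {s : ℝ} (hs : s ∈ Ioc 0 S) :
    eLpNorm (u s) 3 volume ≤ eLpNorm (u 0) 3 volume +
      ENNReal.ofReal (C * ν ^ (-(1 / 2 : ℝ)) *
        (SNormLESNormFDerivOfEqConst (EuclideanSpace ℝ (Fin 3)) (volume : Measure (EuclideanSpace ℝ (Fin 3))) 2 : ℝ) ^ 2 * max K 0 *
          (2 + Real.sqrt 2 * Real.log (T / (T - s)))) := by
  set KSr : ℝ := (SNormLESNormFDerivOfEqConst (EuclideanSpace ℝ (Fin 3)) (volume : Measure (EuclideanSpace ℝ (Fin 3))) 2 : ℝ) with hKSr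
  have hKSr0 : 0 ≤ KSr := NNReal.coe_nonneg _
  set A : ℝ := C * ν ^ (-(1 / 2 : ℝ)) * KSr ^ 2 * max K 0 with hA
  have hK0 : 0 ≤ max K 0 := le_max_right _ _
  have hA0 : 0 ≤ A := by positivity
  have hs0 : 0 < s := hs.1
  have hsS : s ≤ S := hs.2
  have hsT : s < T := lt_of_le_of_lt hsS hST
  have hνs : 0 < ν * s := mul_pos hν hs0
  have h0I : (0 : ℝ) ∈ Icc 0 S := ⟨le_rfl, hS.le⟩
  have hsI : s ∈ Icc 0 S := ⟨hs0.le, hsS⟩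
  have hlog : 0 ≤ Real.log (T / (T - s)) :=
    Real.log_nonneg ((one_le_div (sub_pos.2 hsT)).2 (by linarith))
  -- ### the Oseen representation at time `s` (zero force)
  have hgc : Continuous (uncurry (0 : ℝ → (EuclideanSpace ℝ (Fin 3)) → (EuclideanSpace ℝ (Fin 3)))) := continuous_const
  have hG : ∀ τ ∈ Icc 0 S, ∀ y, ‖(0 : ℝ → (EuclideanSpace ℝ (Fin 3)) → (EuclideanSpace ℝ (Fin 3))) τ y‖ ≤ 0 := fun τ _ y => by simp
  have hgdiv : ∀ τ ∈ Icc 0 S, IsWeaklyDivFree ((0 : ℝ → (EuclideanSpace ℝ (Fin 3)) → (EuclideanSpace ℝ (Fin 3))) τ) := fun τ _ θ _ => by simp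
  have hg2 : ∀ τ ∈ Icc 0 S, eLpNorm ((0 : ℝ → (EuclideanSpace ℝ (Fin 3)) → (EuclideanSpace ℝ (Fin 3))) τ) 2 volume ≤ (0 : ℝ≥0∞) :=
    fun τ _ => by simp
  have hrep := hcl.ae_eq_forced_oseenMild hν hS hgc hG hgdiv ENNReal.zero_ne_top hg2 hE hM hMb hs
  have h0 : ∀ y, forceDuhamel ν 0 (0 : ℝ → (EuclideanSpace ℝ (Fin 3)) → (EuclideanSpace ℝ (Fin 3))) s y = 0 := by
    intro y
    rw [forceDuhamel_apply]
    have hz : ∀ τ, UnboundedOperators.heatExtension ((0 : ℝ → (EuclideanSpace ℝ (Fin 3)) → (EuclideanSpace ℝ (Fin 3))) τ) (ν * (s - τ)) y = 0 := by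
      intro τ
      have : ((0 : ℝ → (EuclideanSpace ℝ (Fin 3)) → (EuclideanSpace ℝ (Fin 3))) τ) = fun _ : (EuclideanSpace ℝ (Fin 3)) => (0 : (EuclideanSpace ℝ (Fin 3))) := rfl
      rw [this, UnboundedOperators.heatExtension_zero_fun]; rfl
    simp_rw [hz, integral_zero]
  have hrep' : u s =ᵐ[volume] fun x =>
      UnboundedOperators.heatExtension (u 0) (ν * s) x - oseenDuhamel ν 0 u u s x := by
    filter_upwards [hrep] with x hx
    rw [hx, h0 x, add_zero]
  -- ### `u 0 ∈ L³` and the caloric term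
  have hu0c : Continuous (u 0) := (hcl.contDiff_velocity h0I).continuous
  have h3top : eLpNorm (u 0) 3 volume < ⊤ := by
    obtain ⟨C', hC', hCb⟩ := hE
    exact eLpNorm_three_lt_top_of_bounded hu0c.aestronglyMeasurable (hMb 0 h0I)
      ((hCb 0 h0I).trans_lt hC')
  have hmem3 : MemLp (u 0) 3 volume := ⟨hu0c.aestronglyMeasurable, h3top⟩
  have hH : eLpNorm (UnboundedOperators.heatExtension (u 0) (ν * s)) 3 volume ≤
      eLpNorm (u 0) 3 volume :=
    UnboundedOperators.eLpNorm_heatExtension_le_holds hmem3 (by norm_num) hνs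
  -- ### the clamped field (globally measurable, `= u` on `[0,S]`)
  set ut : ℝ → (EuclideanSpace ℝ (Fin 3)) → (EuclideanSpace ℝ (Fin 3)) := fun τ y => u (Set.projIcc 0 S hS.le τ : ℝ) y with hut
  have hum : Measurable (uncurry ut) := by
    have hcont : ContinuousOn (uncurry u) (Icc 0 S ×ˢ univ) := hcl.smooth_velocity.continuousOn
    have hφ : Continuous fun q : ℝ × (EuclideanSpace ℝ (Fin 3)) => ((Set.projIcc 0 S hS.le q.1 : ℝ), q.2) :=
      (continuous_subtype_val.comp (continuous_projIcc.comp continuous_fst)).prodMk continuous_snd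
    have hmaps : ∀ q : ℝ × (EuclideanSpace ℝ (Fin 3)),
        ((Set.projIcc 0 S hS.le q.1 : ℝ), q.2) ∈ Icc 0 S ×ˢ (univ : Set (EuclideanSpace ℝ (Fin 3))) :=
      fun q => ⟨(Set.projIcc 0 S hS.le q.1).2, mem_univ _⟩
    have h : Continuous ((uncurry u) ∘ fun q : ℝ × (EuclideanSpace ℝ (Fin 3)) => ((Set.projIcc 0 S hS.le q.1 : ℝ), q.2)) :=
      hcont.comp_continuous hφ hmaps
    exact h.measurable
  have hut_eq : ∀ τ ∈ Icc 0 S, ut τ = u τ := fun τ hτ => by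
    funext y
    simp only [hut, Set.projIcc_of_mem hS.le hτ]
  -- ### the slice bound
  have hslice : ∀ τ ∈ Ioo 0 s,
      eLpNorm (fun x => ∫ y, oseenKernel (ν * (s - τ)) (x - y) (ut τ y) (ut τ y)) 3 volume ≤
        ENNReal.ofReal A * (ENNReal.ofReal ((s - τ) ^ (-(1 / 2 : ℝ))) *
          ENNReal.ofReal ((T - τ) ^ (-(1 / 2 : ℝ)))) := by
    intro τ hτ
    have hτI : τ ∈ Icc 0 S := ⟨hτ.1.le, hτ.2.le.trans hsS⟩
    rw [hut_eq τ hτI]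
    have hστ : 0 < s - τ := sub_pos.2 hτ.2
    have hσ : 0 < ν * (s - τ) := mul_pos hν hστ
    have hTτ : 0 < T - τ := by linarith [hτ.2]
    have hcτ : Continuous (u τ) := (hcl.contDiff_velocity hτI).continuous
    have hmeas : AEStronglyMeasurable (u τ) volume := hcτ.aestronglyMeasurable
    have h1 := hC hσ hmeas hmeas
    have hv2 : MemLp (u τ) 2 volume := by
      obtain ⟨C', hC', hCb⟩ := hE
      refine ⟨hmeas, ?_⟩
      rw [eLpNorm_eq_lintegral_rpow_enorm_toReal two_ne_zero ENNReal.ofNat_ne_top, ENNReal.toReal_ofNat]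
      refine ENNReal.rpow_lt_top_of_nonneg (by norm_num) (ne_of_lt ?_)
      refine lt_of_le_of_lt (le_of_eq (lintegral_congr fun x => ?_)) ((hCb τ hτI).trans_lt hC')
      rw [← ENNReal.rpow_natCast]; norm_num
    have h6 := eLpNorm_six_mul_self_le_curl ((hcl.contDiff_velocity hτI).of_le (by norm_cast))
      (hcl.divFree τ hτI) hv2
    have hKle : ENNReal.ofReal (K / Real.sqrt (T - τ)) ≤
        ENNReal.ofReal (max K 0 * (T - τ) ^ (-(1 / 2 : ℝ))) := by
      apply ENNReal.ofReal_le_ofReal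
      rw [Real.sqrt_eq_rpow, div_eq_mul_inv, ← Real.rpow_neg hTτ.le]
      exact mul_le_mul_of_nonneg_right (le_max_left _ _) (Real.rpow_nonneg hTτ.le _)
    have hKS2 : (SNormLESNormFDerivOfEqConst (EuclideanSpace ℝ (Fin 3)) (volume : Measure (EuclideanSpace ℝ (Fin 3))) 2 : ℝ≥0∞) ^ 2 =
        ENNReal.ofReal (KSr ^ 2) := by
      rw [hKSr, ENNReal.ofReal_pow (NNReal.coe_nonneg _), ENNReal.ofReal_coe_nnreal]
    calc eLpNorm (fun x => ∫ y, oseenKernel (ν * (s - τ)) (x - y) (u τ y) (u τ y)) 3 volume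
        ≤ ENNReal.ofReal (C * (ν * (s - τ)) ^ (-(1 / 2 : ℝ))) *
            (eLpNorm (u τ) 6 volume * eLpNorm (u τ) 6 volume) := h1
      _ ≤ ENNReal.ofReal (C * (ν * (s - τ)) ^ (-(1 / 2 : ℝ))) *
            (ENNReal.ofReal (KSr ^ 2) * ENNReal.ofReal (max K 0 * (T - τ) ^ (-(1 / 2 : ℝ)))) := by
          refine mul_le_mul' le_rfl ?_
          rw [← hKS2]
          exact h6.trans (mul_le_mul' le_rfl ((hquarter τ hτI).trans hKle))
      _ = ENNReal.ofReal A * (ENNReal.ofReal ((s - τ) ^ (-(1 / 2 : ℝ))) *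
            ENNReal.ofReal ((T - τ) ^ (-(1 / 2 : ℝ)))) := by
          have hn1 : 0 ≤ (s - τ) ^ (-(1 / 2 : ℝ)) := Real.rpow_nonneg hστ.le _
          have hn2 : 0 ≤ (T - τ) ^ (-(1 / 2 : ℝ)) := Real.rpow_nonneg hTτ.le _
          have hn3 : 0 ≤ ν ^ (-(1 / 2 : ℝ)) := Real.rpow_nonneg hν.le _
          rw [Real.mul_rpow hν.le hστ.le, ← ENNReal.ofReal_mul (by positivity),
            ← ENNReal.ofReal_mul (by positivity), ← ENNReal.ofReal_mul hn1,
            ← ENNReal.ofReal_mul hA0]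
          congr 1
          rw [hA]
          ring
  -- ### Minkowski in time for the bilinear term
  have hB : eLpNorm (oseenDuhamel ν 0 u u s) 3 volume ≤
      ENNReal.ofReal (A * (2 + Real.sqrt 2 * Real.log (T / (T - s)))) := by
    have heq : oseenDuhamel ν 0 u u s =
        fun x => ∫ τ in Ioo 0 s, ∫ y, oseenKernel (ν * (s - τ)) (x - y) (ut τ y) (ut τ y) := by
      funext x
      rw [oseenDuhamel_apply]
      refine setIntegral_congr_fun measurableSet_Ioo fun τ hτ => ?_
      have hτI : τ ∈ Icc 0 S := ⟨hτ.1.le, hτ.2.le.trans hsS⟩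
      simp only [hut_eq τ hτI]
    have hMink := FunctionSpaces.eLpNorm_integral_le_lintegral_eLpNorm (μ := (volume : Measure (EuclideanSpace ℝ (Fin 3))))
      (ν := volume.restrict (Ioo 0 s)) (aestronglyMeasurable_oseenIntegrand_swap hum hum ν s _)
      (p := 3) (by norm_num) (by norm_num)
    rw [heq]
    calc eLpNorm (fun x => ∫ τ in Ioo 0 s, ∫ y, oseenKernel (ν * (s - τ)) (x - y) (ut τ y) (ut τ y))
          3 volume
        ≤ ∫⁻ τ in Ioo 0 s,
            eLpNorm (fun x => ∫ y, oseenKernel (ν * (s - τ)) (x - y) (ut τ y) (ut τ y)) 3 volume :=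
          hMink
      _ ≤ ∫⁻ τ in Ioo 0 s, ENNReal.ofReal A * (ENNReal.ofReal ((s - τ) ^ (-(1 / 2 : ℝ))) *
            ENNReal.ofReal ((T - τ) ^ (-(1 / 2 : ℝ)))) :=
          setLIntegral_mono' measurableSet_Ioo fun τ hτ => hslice τ hτ
      _ = ENNReal.ofReal A * ∫⁻ τ in Ioo 0 s, ENNReal.ofReal ((s - τ) ^ (-(1 / 2 : ℝ))) *
            ENNReal.ofReal ((T - τ) ^ (-(1 / 2 : ℝ))) :=
          lintegral_const_mul' _ _ ENNReal.ofReal_ne_top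
      _ ≤ ENNReal.ofReal A * ENNReal.ofReal (2 + Real.sqrt 2 * Real.log (T / (T - s))) :=
          mul_le_mul' le_rfl (lintegral_kernel_le_log hs0 hsT)
      _ = ENNReal.ofReal (A * (2 + Real.sqrt 2 * Real.log (T / (T - s)))) :=
          (ENNReal.ofReal_mul hA0).symm
  -- ### measurability of the pieces and assembly
  have hHm : AEStronglyMeasurable (UnboundedOperators.heatExtension (u 0) (ν * s)) volume :=
    (UnboundedOperators.contDiff_heatExtension_holds hmem3 (by norm_num) hνs).continuous.aestronglyMeasurable
  have hum_s : AEStronglyMeasurable (u s) volume :=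
    (hcl.contDiff_velocity hsI).continuous.aestronglyMeasurable
  have hBm : AEStronglyMeasurable (oseenDuhamel ν 0 u u s) volume := by
    have hae : oseenDuhamel ν 0 u u s =ᵐ[volume] fun x =>
        UnboundedOperators.heatExtension (u 0) (ν * s) x - u s x := by
      filter_upwards [hrep'] with x hx
      rw [hx]
      abel
    exact (hHm.sub hum_s).congr hae.symm
  calc eLpNorm (u s) 3 volume
      = eLpNorm (fun x => UnboundedOperators.heatExtension (u 0) (ν * s) x -
          oseenDuhamel ν 0 u u s x) 3 volume := eLpNorm_congr_ae hrep'
    _ ≤ eLpNorm (UnboundedOperators.heatExtension (u 0) (ν * s)) 3 volume +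
          eLpNorm (oseenDuhamel ν 0 u u s) 3 volume := eLpNorm_sub_le hHm hBm (by norm_num)
    _ ≤ eLpNorm (u 0) 3 volume +
          ENNReal.ofReal (A * (2 + Real.sqrt 2 * Real.log (T / (T - s)))) := add_le_add hH hB

/-! ### The route decl -/

/-- **Item stmt-NavierStokesRegularity-23362** (`QuarterLogPincer.LogCubeCeiling`, the converter
crux): under the quarter-rate enstrophy law `∫|curl u(t)|² ≤ K/√(T−t)` a classical Leray–Hopf
solution from a rapidly decaying datum obeys `‖u(t)‖_{L³} ≤ C₁ + C₂ log(T/(T−t))` on `[0,T)`, with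
`C₁ = ‖u(0)‖₃ + 2A`, `C₂ = √2 A`, `A = C ν^{-1/2} K_S² max(K,0)` (`C` the `L³` Oseen slice constant,
`K_S` the Sobolev constant). The Type-I hypothesis of the decl is not used. Proof: Tao-class cover of
`[0,t]` (boundedness, finite energy) and `slab`. NOT a regularity claim: the quarter law is a
hypothesis. [folklore] -/
theorem logCubeCeiling_proof :
    Summit.NavierStokesRegularity.NavierStokesRegularity.Theses.QuarterLogPincer.LogCubeCeiling := by
  unfold Summit.NavierStokesRegularity.NavierStokesRegularity.Theses.QuarterLogPincer.LogCubeCeiling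
  intro ν T hν hT u p hcl hLH hdec K hK _hI
  obtain ⟨C, hC0, hC⟩ := exists_eLpNorm_three_oseenSlice_le (E := (EuclideanSpace ℝ (Fin 3)))
  set KSr : ℝ := (SNormLESNormFDerivOfEqConst (EuclideanSpace ℝ (Fin 3)) (volume : Measure (EuclideanSpace ℝ (Fin 3))) 2 : ℝ) with hKSr
  set A : ℝ := C * ν ^ (-(1 / 2 : ℝ)) * KSr ^ 2 * max K 0 with hA
  have hK0 : 0 ≤ max K 0 := le_max_right _ _
  have hKSr0 : 0 ≤ KSr := NNReal.coe_nonneg _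
  have hA0 : 0 ≤ A := by positivity
  -- `u 0 ∈ L³` (Tao-class cover of `[0, T/2]`: bounded with finite energy)
  obtain ⟨q₀, hcl₀, hu₀, -, -⟩ := RungReynoldsOne.stub_taoCover hν hT hcl hLH hdec (T' := T / 2)
    ⟨by positivity, by linarith⟩
  obtain ⟨B₀, -, hB₀⟩ := exists_forall_norm_le_of_hasBoundedSobolevNormsOn hcl₀ hu₀
  have hE0 : ∫⁻ x, ‖u 0 x‖ₑ ^ 2 < ⊤ :=
    (hLH.lintegral_enorm_sq_le hν.le ⟨le_rfl, hT.le⟩).trans_lt ENNReal.ofReal_lt_top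
  have h3top : eLpNorm (u 0) 3 volume < ⊤ :=
    eLpNorm_three_lt_top_of_bounded
      (hcl.contDiff_velocity ⟨le_rfl, hT⟩).continuous.aestronglyMeasurable
      (hB₀ 0 ⟨le_rfl, by positivity⟩) hE0
  set a : ℝ := (eLpNorm (u 0) 3 volume).toReal with ha
  have ha0 : 0 ≤ a := ENNReal.toReal_nonneg
  have ha3 : eLpNorm (u 0) 3 volume = ENNReal.ofReal a := (ENNReal.ofReal_toReal h3top.ne).symm
  refine ⟨a + 2 * A, Real.sqrt 2 * A, fun t ht => ?_⟩
  rcases eq_or_lt_of_le ht.1 with h0 | ht0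
  · -- `t = 0`
    rw [← h0, sub_zero, div_self hT.ne', Real.log_one, mul_zero, add_zero, ha3]
    exact ENNReal.ofReal_le_ofReal (by linarith)
  · -- `0 < t < T`: the slab `[0, t]`
    obtain ⟨q, hclq, huq, -, -⟩ := RungReynoldsOne.stub_taoCover hν hT hcl hLH hdec (T' := t) ⟨ht0, ht.2⟩
    obtain ⟨B, -, hB⟩ := exists_forall_norm_le_of_hasBoundedSobolevNormsOn hclq huq
    have hE : ∃ C' : ℝ≥0∞, C' < ⊤ ∧ ∀ τ ∈ Icc 0 t, ∫⁻ x, ‖u τ x‖ₑ ^ 2 ≤ C' :=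
      ⟨ENNReal.ofReal (2 * VectorCalculus.kineticEnergy (u 0)), ENNReal.ofReal_lt_top,
        fun τ hτ => hLH.lintegral_enorm_sq_le hν.le ⟨hτ.1, hτ.2.trans ht.2.le⟩⟩
    have hMb : ∀ τ ∈ Icc 0 t, ∀ y, ‖u τ y‖ ≤ max B 1 := fun τ hτ y =>
      (hB τ hτ y).trans (le_max_left _ _)
    have hquarter : ∀ τ ∈ Icc 0 t,
        ∫⁻ x, ‖curl (u τ) x‖ₑ ^ 2 ≤ ENNReal.ofReal (K / Real.sqrt (T - τ)) :=
      fun τ hτ => hK τ ⟨hτ.1, hτ.2.trans_lt ht.2⟩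
    have h := slab hν ht0 ht.2 hclq hE (lt_max_of_lt_right one_pos) hMb hquarter hC0
      (fun hσ _ _ ha hb => hC hσ ha hb) ⟨ht0, le_rfl⟩
    have hlog : 0 ≤ Real.log (T / (T - t)) :=
      Real.log_nonneg ((one_le_div (sub_pos.2 ht.2)).2 (by linarith))
    rw [ha3, ← ENNReal.ofReal_add ha0 (by positivity)] at h
    refine h.trans (le_of_eq ?_)
    congr 1
    rw [hA]
    ring

end LogCubeCeiling

end Summit.NavierStokesRegularity.NavierStokesRegularity.Theorems

end
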